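import Mathlib

/-!
# Implicit differentiation at root nodes of log-free term germs

This file provides the calculus input at the ROOT nodes of log-free term germs for the line
`generic-period-fibre` of the crux `RigidCore.SchanuelOnLogFreeCore`.

If `g` is differentiable at `z` with derivative `g'`, the coefficient functions `aᵢ` (`i < d`) are
differentiable at `z` with derivatives `aᵢ'`, and `g` is, near `z`, a root of the monic polynomial
`Y ^ d + Σ_{i<d} aᵢ(w) Yⁱ`, i.e. `g(w) ^ d + Σ aᵢ(w) g(w)ⁱ = 0` for all `w` in a neighbourhood of
`z`, then differentiating this identity at `z` gives the linear relation

`g' * (d * g(z) ^ (d-1) + Σ i * aᵢ(z) * g(z) ^ (i-1)) + Σ aᵢ' * g(z)ⁱ = 0`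

between `g'`, the `aᵢ'` and the value of `∂_Y` at the root.  (The `i = 0` summand of the
`∂_Y`-expression vanishes through the factor `((0 : ℕ) : ℂ) = 0`, matching Mathlib's convention
`↑n * f x ^ (n - 1) * f'` in `HasDerivAt.pow` at `n = 0`.)

## Proof

Let `Φ w = g w ^ d + Σ aᵢ w * g w ^ i`.  By `HasDerivAt.fun_pow`, `HasDerivAt.fun_mul`,
`HasDerivAt.fun_sum` and `HasDerivAt.fun_add`, `Φ` has derivative
`d * g z ^ (d-1) * g' + Σ (aᵢ' * g z ^ i + aᵢ z * (i * g z ^ (i-1) * g'))` at `z`; since `Φ`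
vanishes on a neighbourhood of `z` it also has derivative `0` there
(`HasDerivAt.congr_of_eventuallyEq` from the constant function).  Uniqueness of derivatives
(`HasDerivAt.unique`) and a rearrangement of the finite sums finish the proof.
-/

noncomputable section

namespace Summit.Schanuel.Schanuel.Theorems.RigidCore

/-- **Implicit differentiation at a root.**  If `g` (derivative `g'` at `z`) is, on a neighbourhood
of `z`, a root of the monic polynomial `Y ^ d + Σ_{i<d} aᵢ(w) Yⁱ` whose coefficients `aᵢ` have
derivatives `aᵢ'` at `z`, then
`g' * (d * g z ^ (d-1) + Σ i * aᵢ z * g z ^ (i-1)) + Σ aᵢ' * g z ^ i = 0`. -/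
theorem stub_implicitDeriv :
    ∀ (d : ℕ) (a : Fin d → ℂ → ℂ) (a' : Fin d → ℂ) (g : ℂ → ℂ) (z g' : ℂ),
      (∀ i, HasDerivAt (a i) (a' i) z) → HasDerivAt g g' z →
      (∀ᶠ w in nhds z, g w ^ d + ∑ i : Fin d, a i w * g w ^ (i : ℕ) = 0) →
        g' * ((d : ℂ) * g z ^ (d - 1) + ∑ i : Fin d, ((i : ℕ) : ℂ) * a i z * g z ^ ((i : ℕ) - 1)) +
          ∑ i : Fin d, a' i * g z ^ (i : ℕ) = 0 := by
  intro d a a' g z g' ha hg hroot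
  -- The derivative of `Φ w = g w ^ d + Σ aᵢ w * g w ^ i` at `z`, computed by the calculus rules.
  have hΦ : HasDerivAt (fun w => g w ^ d + ∑ i : Fin d, a i w * g w ^ (i : ℕ))
      ((d : ℂ) * g z ^ (d - 1) * g' +
        ∑ i : Fin d, (a' i * g z ^ (i : ℕ) +
          a i z * ((((i : ℕ) : ℂ)) * g z ^ ((i : ℕ) - 1) * g'))) z :=
    (hg.fun_pow d).fun_add
      (HasDerivAt.fun_sum fun i _ => (ha i).fun_mul (hg.fun_pow (i : ℕ)))
  -- `Φ` vanishes near `z`, hence also has derivative `0` at `z`.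
  have hΦ₀ : HasDerivAt (fun w => g w ^ d + ∑ i : Fin d, a i w * g w ^ (i : ℕ)) 0 z :=
    (hasDerivAt_const z (0 : ℂ)).congr_of_eventuallyEq (hroot.mono fun _ hw => hw)
  -- Uniqueness of the derivative, then rearrange the finite sums.
  have huniq := hΦ.unique hΦ₀
  rw [Finset.sum_add_distrib] at huniq
  have hkey : g' * ∑ i : Fin d, ((i : ℕ) : ℂ) * a i z * g z ^ ((i : ℕ) - 1) =
      ∑ i : Fin d, a i z * ((((i : ℕ) : ℂ)) * g z ^ ((i : ℕ) - 1) * g') := by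
    rw [Finset.mul_sum]
    exact Finset.sum_congr rfl fun i _ => by ring
  linear_combination huniq + hkey

end Summit.Schanuel.Schanuel.Theorems.RigidCore

end
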